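import Summits.BirchSwinnertonDyer.BirchSwinnertonDyer.Theorems.UniversalToricDescentGoodLocalTermTrichotomy
import HarnessLib

/-!
# Route UniversalToricDescent — Greenberg–Vatsal Prop. (2.4) at a good place, in the `Gal(K̄/K_∞) ⊓ D_v`
# currency: `#H¹(ker κ ⊓ D_v, E[p^∞])[p] = p^{d_v}`

Lead prover bsd-wall-utd-p1 g9 (`--supports stmt-BirchSwinnertonDyer-20399`). The closed form of
`UniversalToricDescentGoodLocalTermTrichotomy.natCard_pTorsion_subgroupH1_kerD_eq_pow` (stated for the
route's `kerD κ v ≤ D_v`) transported to the subgroup `ker κ ⊓ D_v ≤ Γ_K` used by the tree's cyclotomic /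
fine-Selmer files (`CyclotomicLocalTorsionDivisibleProofs`, `FineSelmerTorsionCoefficientsFiniteProofs`,
`GreenbergVatsal2000.NonPrimitiveSelmerGroup`): the two groups are isomorphic (the same subgroup of `Γ_K`
seen inside `D_v`, resp. inside `Γ_K`), and inflation along either surjection is injective on `H¹`
(`resH1Hom_injective_of_surjective`).

* `natCard_pTorsion_subgroupH1_inf_decomp_eq_kerD` — `#H¹(ker κ ⊓ D_v, M)[p] = #H¹(kerD κ v, M)[p]`
  for every discrete `Γ_K`-module `M` at a finitely decomposed `v ∤ p` (for `M = E[p^∞]`, both finite).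
* **`natCard_pTorsion_subgroupH1_inf_decomp_eq_pow`** — for `E/K` good at `v ∤ p`, `D_v ⊄ ker κ`:
  `#{x ∈ H¹(ker κ ⊓ D_v, E[p^∞]) : p•x = 0} = p^{d_v}`, `d_v ∈ {0,1,2}` read off `(a_v, q_v) mod p`.

THEOREMS ONLY; no definition, no named fact, no `sorry`. BSD is not advanced by this file.
References: [GreenbergVatsal2000] §2 Prop. (2.4) (p. 22); [GreenbergLNM1716] §3 Lemma 3.3.
-/

set_option autoImplicit false
-- `…BirchSwinnertonDyer.BirchSwinnertonDyer.Theorems…` is the problem's mandated namespace (D-0017).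
set_option linter.dupNamespace false

noncomputable section

open scoped Classical

namespace Summit.BirchSwinnertonDyer.BirchSwinnertonDyer.Theorems.UniversalToricDescentGoodLocalTermTrichotomy

open Function NumberField IsDedekindDomain Field WeierstrassCurve
open Literature.NumberTheory.EllipticCurves Literature.NumberTheory.EllipticCurves.GreenbergSelmer
  Literature.NumberTheory.GaloisRepresentations IsDedekindDomain.HeightOneSpectrum
  Summit.BirchSwinnertonDyer.Rank1Residual.X11b Summit.BirchSwinnertonDyer.Rank1Residual.X11b.Coinv
  Summit.BirchSwinnertonDyer.Rank1Residual.Iwasawa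
  Summit.BirchSwinnertonDyer.BirchSwinnertonDyer.Theorems.UniversalToricDescentSigmaPassage
  Summit.BirchSwinnertonDyer.BirchSwinnertonDyer.Theorems.UniversalToricDescentSigmaLocalImage
  Summit.BirchSwinnertonDyer.BirchSwinnertonDyer.Theorems.UniversalToricDescentGoodLocalTerm

variable {K : Type} [Field K] [NumberField K] (W : WeierstrassCurve K) [W.IsElliptic] {p : ℕ}
  [Fact p.Prime] (κ : ZpExtension K p) {v : HeightOneSpectrum (𝓞 K)}

/-- **`#H¹(ker κ ⊓ D_v, E[p^∞])[p] = #H¹(kerD κ v, E[p^∞])[p]`** at a finitely decomposed `v ∤ p`: the two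
groups are the same subgroup of `Γ_K` seen inside `Γ_K`, resp. inside `D_v`; the two inflations are
injective on `H¹` and both `p`-torsion groups are finite. [cite: GreenbergLNM1716, §3 Lemma 3.3] -/
theorem natCard_pTorsion_subgroupH1_inf_decomp_eq_kerD (hpv : (p : 𝓞 K) ∉ v.asIdeal)
    (hD : ¬ (decomp v ≤ κ.kerSubgroup)) :
    Nat.card {x : Literature.NumberTheory.EllipticCurves.subgroupH1 (κ.kerSubgroup ⊓ decomp v)
        (W.geomPrimaryTorsion p) // p • x = 0} =
      Nat.card {f : Literature.NumberTheory.EllipticCurves.subgroupH1 (kerD κ v)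
        (W.geomPrimaryTorsion p) // p • f = 0} := by
  let A : Type := W.geomPrimaryTorsion p
  let D : Subgroup (absoluteGaloisGroup K) := κ.kerSubgroup ⊓ decomp v
  obtain ⟨ρ, hρ⟩ := exists_injective_subgroupH1_kerD κ (M := A) v
  let θ₃ : kerD κ v →ₜ* D :=
    { toFun := fun x ↦ ⟨((x : decomp (K := K) v) : absoluteGaloisGroup K),
        Subgroup.mem_inf.mpr ⟨(mem_kerD_iff κ v _).1 x.2, (x : decomp (K := K) v).2⟩⟩
      map_one' := rfl
      map_mul' := fun _ _ ↦ rfl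
      continuous_toFun := (continuous_subtype_val.comp continuous_subtype_val).subtype_mk _ }
  have hθ₃ : Surjective θ₃ := fun d ↦
    ⟨⟨⟨(d : absoluteGaloisGroup K), (Subgroup.mem_inf.mp d.2).2⟩,
      (mem_kerD_iff κ v _).2 (Subgroup.mem_inf.mp d.2).1⟩, rfl⟩
  let ρ' := resH1Hom θ₃ (AddMonoidHom.id A) fun x m ↦ (rfl : θ₃ x • m = x • m)
  have hρ' : Injective ρ' := resH1Hom_injective_of_surjective θ₃ hθ₃ fun _ _ ↦ rfl
  haveI := finite_pTorsion_subgroupH1_kerD W κ hpv hD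
  haveI : Finite {x : Literature.NumberTheory.EllipticCurves.subgroupH1 D A // p • x = 0} :=
    (finite_pTorsion_subgroupH1_inf_decomp W κ hpv hD).to_subtype
  refine natCard_eq_of_injective_of_injective
    (f := fun x ↦ ⟨ρ' x.1, by rw [← map_nsmul, x.2, map_zero]⟩)
    (g := fun f ↦ ⟨ρ f.1, by rw [← map_nsmul, f.2, map_zero]⟩) ?_ ?_
  · intro a b h; exact Subtype.ext (hρ' (congrArg Subtype.val h))
  · intro a b h; exact Subtype.ext (hρ (congrArg Subtype.val h))

/-- **Greenberg–Vatsal Prop. (2.4) at a good place, `ker κ ⊓ D_v` currency**: for `E/K` with good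
reduction at `v ∤ p` finitely decomposed in the `ℤ_p`-extension `κ`:
`#{x ∈ H¹(ker κ ⊓ D_v, E[p^∞]) : p•x = 0} = p^{d_v}` with `d_v = 0` if `p ∤ q_v + 1 − a_v`, `d_v = 2` if
`p ∣ q_v + 1 − a_v` and `p ∣ q_v − 1`, `d_v = 1` otherwise. [cite: GreenbergVatsal2000, §2 Prop. (2.4) (p. 22)] -/
theorem natCard_pTorsion_subgroupH1_inf_decomp_eq_pow (hpv : (p : 𝓞 K) ∉ v.asIdeal)
    (hD : ¬ (decomp v ≤ κ.kerSubgroup)) (hv : W.HasGoodReductionAt v) :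
    Nat.card {x : Literature.NumberTheory.EllipticCurves.subgroupH1 (κ.kerSubgroup ⊓ decomp v)
        (W.geomPrimaryTorsion p) // p • x = 0} =
      p ^ (if (p : ℤ) ∣ (Nat.card (IsLocalRing.ResidueField (v.adicCompletionIntegers K)) : ℤ) + 1 -
              W.frobeniusTraceAt v then
            (if (p : ℤ) ∣ (Nat.card (IsLocalRing.ResidueField (v.adicCompletionIntegers K)) : ℤ) - 1
              then 2 else 1)
          else 0) := by
  rw [natCard_pTorsion_subgroupH1_inf_decomp_eq_kerD W κ hpv hD]
  exact natCard_pTorsion_subgroupH1_kerD_eq_pow W κ hpv hD hv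

end Summit.BirchSwinnertonDyer.BirchSwinnertonDyer.Theorems.UniversalToricDescentGoodLocalTermTrichotomy

end
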